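import Mathlib
import HarnessLib
import Literature.Analysis.OperatorTheory.HeterogeneousCyclicPeeling
import Literature.Combinatorics.SimpleGraph.EliminationGraph
import Summits.Ventures.LatticeQCDFlow.Exactness.LatticeCoordAvg
import Summits.Ventures.LatticeQCDFlow.Scaling.EliminationFrontComponents

/-!
# LatticeQCDFlow / Scaling — the exact autoregressive context of a FACTORISING weight: a factor
# that does not read the integrated block around the current variable cancels from the conditional
# (the Markov / elimination-frontier UPPER bound, abstract form)

HONEST FRAMING: exact (Metropolis-corrected) sampling algorithms for lattice gauge theory;
figures of merit are autocorrelation/cost numbers at stated couplings and volumes; no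
continuum-physics claim.

Venture `LatticeQCDFlow` (cell pub-lqcd), topic `Scaling`, FANOUT row 30 (lean-1, GEN-16) — OUR WORK on
THEORY-2.md §3.1 / §4 row T2-AF (a) and conjecture C5.  THEORY-2 cites (E27, Spantini–Bigoni–Marzouk
2018 Thm 5.1, row L-10, "used here only in words") the UPPER half of the triangular-footprint
bracket: for a target globally Markov w.r.t. a graph `G` and a product reference, the `k`-th exact
Knothe–Rosenblatt conditional reads only `x_k` and the elimination frontier `neigh(k, G^k)`.  This
file types the mechanism behind it in the tree's own vocabulary — coordinate averages
`A_s w = Exactness.coordAvg μ s w` (integrate the coordinates in `s` against fresh i.i.d. samples of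
the probability measure `μ`, keep the rest; `Exactness/LatticeCoordAvg.lean`) and the exact
autoregressive conditional `A_s w / A_{insert a s} w` of the variable `a` given the generated ones
(the not-yet-generated block `s` integrated; GEN-14/15 `Scaling/AutoregressiveGaugeRedundancy*`,
`Scaling/AutoregressiveContextLaw`) — for ANY index set `ι` (sites, links, …), any measurable space
`X`, any probability measure `μ`, no topology, no graph:

* §1 `coordAvg_congr_of_dependsOn` — `A_s w` reads only the coordinates `w` reads, off `s`;
  `coordAvg_insert_of_not_dependsOn` — integrating a coordinate that `w` does not read changes
  nothing: `A_{insert a s} w = A_s w`.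
* §2 **`coordAvg_mul_of_disjoint_reads`** — INDEPENDENT BLOCKS: if `w₁` reads (`DependsOn`) only `V₁`,
  `w₂` only `V₂`, and no coordinate of `s` is read by both, then `A_s (w₁ w₂) = A_s w₁ · A_s w₂`
  (Fubini over the two blocks of integrated coordinates, via the tree's
  `Literature.Analysis.OperatorTheory.integral_pi_mul_split`).
* §3 **`arConditional_eq_of_factor`** — THE CANCELLATION: if `w = w₁ w₂` with `w₂` reading neither
  `a` nor any `s`-coordinate read by `w₁`, and `A_s w₂ ≠ 0` at the configuration, then
  `A_s w / A_{insert a s} w = A_s w₁ / A_{insert a s} w₁`; hence **`arConditional_congr_of_factor`**: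
  the exact conditional of `a` takes the same value on configurations that agree on the coordinates
  read by `w₁` off `s` — THE CONTEXT OF `a` IS CONTAINED IN `(V₁ ∖ s)`, whatever else `w` couples.
* §4 FACTORISING WEIGHTS `w = ∏_t f t` (term `t` reading `rd t`): `arConditional_prod_congr_of_closedBlock`
  (a block `K ∋ a` inside `insert a s` closed for the terms ⇒ the context of `a` is contained in the
  coordinates read by the terms touching `K`, off `s`), `…_pos` (positive bounded measurable terms: no
  side condition).
* §5 THE GRAPH FORM — **`arConditional_congr_of_frontier`**, **`arConditional_congr_of_higherAdj`**:
  for terms reading CLIQUES of a graph `G` on the variables and ANY linear order (generate from the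
  top; `s = {u | u < a}`), the exact KR conditional of `a` reads only `a` and the outer boundary of
  the LOWER COMPONENT of `a` (GEN-14 `Scaling/EliminationFrontComponents`) = the higher
  fill-neighbourhood `adj⁺(a)` of the elimination graph (`higherAdj_elimGraph_eq_outer_lowerComp`) —
  THE UPPER HALF OF THE TRIANGULAR-FOOTPRINT BRACKET (T2-AF (a), E27 Thm 5.1), typed.

READING (value-free, for THEORY-2 §4 T2-AF (a) / C5): for a nearest-neighbour (graph-Markov)
weight take `w₁` = the product of the interaction terms touching the connected component `K` of `a`
in `G[s ∪ {a}]` and `w₂` = the rest: `V₁ = K ∪ ∂K`, so the context of `a` is contained in the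
frontier `∂K ∖ s` = the higher fill-neighbourhood of `a` (GEN-14 `higherAdj_elimGraph_eq_outer_lowerComp`)
— the cited upper bound, for every factorising weight and every reference product measure; C5 asks
whether interacting actions attain it (the Gaussian free field does: GEN-14; pure gauge theory in link
variables does NOT: GEN-15/16).  Instances (Wilson links, nearest-neighbour sites) are the sequel
`Scaling/AutoregressiveFrontierInstances`.  NOT CLAIMED: any lower bound; unbounded or signed terms in
§5 (use §4's closed-block theorem with its explicit non-vanishing hypothesis);
integrability bookkeeping beyond what the statements say (the product rule needs none: it is an
identity of Bochner integrals over a product of two probability spaces); any number of ours.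
Elementary over the two parents; no definition is introduced (`DependsOn` is Mathlib's); nothing is
cited as a fact; no `sorry`.
-/

noncomputable section

namespace Summit.Ventures.LatticeQCDFlow.Theory2.Autoregressive

open MeasureTheory Function
open Summit.Ventures.LatticeQCDFlow.Exactness

variable {ι : Type*} [Fintype ι] [DecidableEq ι]
variable {X : Type*} [MeasurableSpace X]
variable (μ : Measure X)

/-! ## §1 What a coordinate average reads -/

/-- `A_s w` reads only the coordinates OFF `s` that `w` reads: if `w` depends only on `V` and
`ω, ω'` agree on `V ∖ s`, then `A_s w (ω) = A_s w (ω')`. [ours] -/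
theorem coordAvg_congr_of_dependsOn (s : Finset ι) {w : (ι → X) → ℝ} {V : Set ι}
    (hw : DependsOn w V) {ω ω' : ι → X} (h : ∀ i ∈ V, i ∉ s → ω i = ω' i) :
    coordAvg μ s w ω = coordAvg μ s w ω' := by
  unfold coordAvg
  congr 1
  funext v
  refine hw fun i hi => ?_
  by_cases his : i ∈ s
  · simp [Finset.piecewise_eq_of_mem _ _ _ his]
  · simp [Finset.piecewise_eq_of_notMem _ _ _ his, h i hi his]

/-- Integrating one more coordinate that `w` does not read changes nothing:
`A_{insert a s} w = A_s w` when `w` depends only on `V ∌ a`. [ours] -/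
theorem coordAvg_insert_of_not_dependsOn (s : Finset ι) (a : ι) {w : (ι → X) → ℝ} {V : Set ι}
    (hw : DependsOn w V) (ha : a ∉ V) (ω : ι → X) :
    coordAvg μ (insert a s) w ω = coordAvg μ s w ω := by
  unfold coordAvg
  congr 1
  funext v
  refine hw fun i hi => ?_
  have hia : i ≠ a := fun h => ha (h ▸ hi)
  by_cases his : i ∈ s
  · simp [Finset.piecewise_eq_of_mem _ _ _ his,
      Finset.piecewise_eq_of_mem _ _ _ (Finset.mem_insert_of_mem his)]
  · have : i ∉ insert a s := by simp [hia, his]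
    simp [Finset.piecewise_eq_of_notMem _ _ _ his, Finset.piecewise_eq_of_notMem _ _ _ this]

/-! ## §2 Independent blocks: the product rule -/

variable [IsProbabilityMeasure μ]

/-- **Independent blocks of integrated coordinates.**  If `w₁` reads only `V₁`, `w₂` reads only
`V₂`, and no coordinate of `s` is read by both (`V₁ ∩ V₂ ∩ s = ∅`), then
`A_s (w₁ · w₂) = A_s w₁ · A_s w₂`: under the product reference measure the `s ∩ V₁`-block and the
remaining integrated coordinates are independent. [ours] -/
theorem coordAvg_mul_of_disjoint_reads (s : Finset ι) {w₁ w₂ : (ι → X) → ℝ} {V₁ V₂ : Set ι}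
    (hw₁ : DependsOn w₁ V₁) (hw₂ : DependsOn w₂ V₂) (hdisj : ∀ i ∈ s, i ∈ V₁ → i ∉ V₂)
    (ω : ι → X) :
    coordAvg μ s (fun η => w₁ η * w₂ η) ω = coordAvg μ s w₁ ω * coordAvg μ s w₂ ω := by
  classical
  -- split the integration variables into the block `p = (· ∈ s ∩ V₁)` and the rest
  let p : ι → Prop := fun i => i ∈ s ∧ i ∈ V₁
  -- `w₁ (s.piecewise v ω)` as a function of the `p`-block of `v`
  let a : ({i // p i} → X) → ℝ := fun x => w₁ (fun i => if h : p i then x ⟨i, h⟩ else ω i)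
  -- `w₂ (s.piecewise v ω)` as a function of the complementary block of `v`
  let b : ({i // ¬ p i} → X) → ℝ :=
    fun y => w₂ (fun i => if h : p i then ω i else if i ∈ s then y ⟨i, h⟩ else ω i)
  have ha : ∀ v : ι → X, w₁ (s.piecewise v ω) = a (fun i => v i) := by
    intro v
    refine hw₁ fun i hi => ?_
    by_cases his : i ∈ s
    · have : p i := ⟨his, hi⟩
      simp [Finset.piecewise_eq_of_mem _ _ _ his, this]
    · have : ¬ p i := fun h => his h.1
      simp [Finset.piecewise_eq_of_notMem _ _ _ his, this]
  have hb : ∀ v : ι → X, w₂ (s.piecewise v ω) = b (fun i => v i) := by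
    intro v
    refine hw₂ fun i hi => ?_
    have : ¬ p i := fun h => hdisj i h.1 h.2 hi
    by_cases his : i ∈ s
    · simp [this, his]
    · simp [this, his]
  have h1 : coordAvg μ s w₁ ω = ∫ x, a x ∂Measure.pi fun _ => μ := by
    unfold coordAvg
    simp_rw [ha]
    -- `∫ a (v|p) dπ(v) = ∫ a dπ_p`: the product rule with second factor `1`
    have := Literature.Analysis.OperatorTheory.integral_pi_mul_split p μ a (fun _ => (1 : ℝ))
    simpa using this
  have h2 : coordAvg μ s w₂ ω = ∫ y, b y ∂Measure.pi fun _ => μ := by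
    unfold coordAvg
    simp_rw [hb]
    have := Literature.Analysis.OperatorTheory.integral_pi_mul_split p μ (fun _ => (1 : ℝ)) b
    simpa using this
  have h12 : coordAvg μ s (fun η => w₁ η * w₂ η) ω =
      (∫ x, a x ∂Measure.pi fun _ => μ) * ∫ y, b y ∂Measure.pi fun _ => μ := by
    unfold coordAvg
    simp_rw [ha, hb]
    exact Literature.Analysis.OperatorTheory.integral_pi_mul_split p μ a b
  rw [h12, h1, h2]

/-! ## §3 The cancellation: a factor that does not read the block around `a` drops out of the
conditional -/

/-- **THE CANCELLATION.**  Let `w = w₁ · w₂` where `w₁` reads only `V₁`, `w₂` reads only `V₂`,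
`a ∉ V₂`, and no coordinate of `s` is read by both.  If `A_s w₂ (ω) ≠ 0` (e.g. `w₂ > 0`), then the
exact conditional of `a` computed from `w` equals the one computed from `w₁` alone:
`A_s w / A_{insert a s} w = A_s w₁ / A_{insert a s} w₁` at `ω`. [ours] -/
theorem arConditional_eq_of_factor (s : Finset ι) (a : ι) {w₁ w₂ : (ι → X) → ℝ} {V₁ V₂ : Set ι}
    (hw₁ : DependsOn w₁ V₁) (hw₂ : DependsOn w₂ V₂) (ha : a ∉ V₂)
    (hdisj : ∀ i ∈ s, i ∈ V₁ → i ∉ V₂) (ω : ι → X) (hne : coordAvg μ s w₂ ω ≠ 0) :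
    coordAvg μ s (fun η => w₁ η * w₂ η) ω / coordAvg μ (insert a s) (fun η => w₁ η * w₂ η) ω =
      coordAvg μ s w₁ ω / coordAvg μ (insert a s) w₁ ω := by
  have hdisj' : ∀ i ∈ insert a s, i ∈ V₁ → i ∉ V₂ := by
    intro i hi hi1
    rcases Finset.mem_insert.1 hi with rfl | his
    · exact ha
    · exact hdisj i his hi1
  rw [coordAvg_mul_of_disjoint_reads μ s hw₁ hw₂ hdisj ω,
    coordAvg_mul_of_disjoint_reads μ (insert a s) hw₁ hw₂ hdisj' ω,
    coordAvg_insert_of_not_dependsOn μ s a hw₂ ha ω, mul_div_mul_right _ _ hne]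

/-- **THE CONTEXT OF `a` IS CONTAINED IN THE COORDINATES READ BY THE BLOCK FACTOR, OFF `s`.**  Under
the hypotheses of `arConditional_eq_of_factor` at two configurations `ω, ω'` that agree on `V₁ ∖ s`,
the exact conditional `A_s w / A_{insert a s} w` of `a` takes the same value at `ω` and `ω'` —
whatever the other factor `w₂` couples. [ours] -/
theorem arConditional_congr_of_factor (s : Finset ι) (a : ι) {w₁ w₂ : (ι → X) → ℝ} {V₁ V₂ : Set ι}
    (hw₁ : DependsOn w₁ V₁) (hw₂ : DependsOn w₂ V₂) (ha : a ∉ V₂)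
    (hdisj : ∀ i ∈ s, i ∈ V₁ → i ∉ V₂) {ω ω' : ι → X} (hne : coordAvg μ s w₂ ω ≠ 0)
    (hne' : coordAvg μ s w₂ ω' ≠ 0) (h : ∀ i ∈ V₁, i ∉ s → ω i = ω' i) :
    coordAvg μ s (fun η => w₁ η * w₂ η) ω / coordAvg μ (insert a s) (fun η => w₁ η * w₂ η) ω =
      coordAvg μ s (fun η => w₁ η * w₂ η) ω' /
        coordAvg μ (insert a s) (fun η => w₁ η * w₂ η) ω' := by
  rw [arConditional_eq_of_factor μ s a hw₁ hw₂ ha hdisj ω hne,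
    arConditional_eq_of_factor μ s a hw₁ hw₂ ha hdisj ω' hne',
    coordAvg_congr_of_dependsOn μ s hw₁ h,
    coordAvg_congr_of_dependsOn μ (insert a s) hw₁ fun i hi his =>
      h i hi fun h' => his (Finset.mem_insert_of_mem h')]

/-- The nonvanishing hypothesis holds for POSITIVE factors: `A_s w₂ > 0` when `w₂ > 0` pointwise
and `η ↦ w₂ (s.piecewise η ω)` is integrable (e.g. bounded, or continuous on a compact product).
[ours] -/
theorem coordAvg_pos_of_pos (s : Finset ι) {w₂ : (ι → X) → ℝ} (hpos : ∀ η, 0 < w₂ η) (ω : ι → X)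
    (hint : Integrable (fun η : ι → X => w₂ (s.piecewise η ω)) (Measure.pi fun _ => μ)) :
    0 < coordAvg μ s w₂ ω := by
  unfold coordAvg
  rw [integral_pos_iff_support_of_nonneg (fun η => (hpos _).le) hint,
    Set.eq_univ_of_forall fun η => Function.mem_support.2 (hpos (s.piecewise η ω)).ne',
    measure_univ]
  exact one_pos

/-! ## §4 Factorising weights: the terms touching a closed block around `a`, and the frontier -/

section Block

variable {τ : Type*} [Fintype τ]

omit [Fintype ι] [DecidableEq ι] [MeasurableSpace X] in
/-- A finite product of terms, each reading only `rd t`, reads only the union of the `rd t`.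
[ours] -/
theorem dependsOn_prod_filter (f : τ → (ι → X) → ℝ) (rd : τ → Finset ι)
    (hf : ∀ t, DependsOn (f t) (rd t : Set ι)) (P : τ → Prop) [DecidablePred P] :
    DependsOn (fun η : ι → X => ∏ t ∈ Finset.univ.filter P, f t η)
      {i | ∃ t, P t ∧ i ∈ rd t} := by
  intro x y hxy
  refine Finset.prod_congr rfl fun t ht => hf t fun i hi => hxy i ⟨t, (Finset.mem_filter.1 ht).2, hi⟩

/-- **THE FRONTIER BOUND FOR A FACTORISING WEIGHT (closed-block form).**  Let `w = ∏_t f t`, the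
term `t` reading only the coordinates `rd t`.  Let `K ∋ a` be a block of coordinates inside
`insert a s` that is CLOSED for the terms: every term touching `K` reads, inside `insert a s`, only
coordinates of `K` (for a nearest-neighbour action: `K` = the connected component of `a` among the
not-yet-generated variables and `a`).  Then the exact conditional `A_s w / A_{insert a s} w` of `a`
takes the same value on any two configurations that agree, off `s`, on the coordinates read by the
terms touching `K` — i.e. on `a` and on the FRONTIER of `K` (the generated variables sharing a term
with the block) — provided the complementary factor has non-zero average at both (automatic for
positive terms, `coordAvg_pos_of_pos`).  The terms not touching `K` cancel
(`arConditional_congr_of_factor`). [ours] -/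
theorem arConditional_prod_congr_of_closedBlock (s : Finset ι) (a : ι) (f : τ → (ι → X) → ℝ)
    (rd : τ → Finset ι) (hf : ∀ t, DependsOn (f t) (rd t : Set ι)) (K : Finset ι) (haK : a ∈ K)
    (hclosed : ∀ t, (∃ j ∈ K, j ∈ rd t) → ∀ i ∈ rd t, i ∈ insert a s → i ∈ K)
    {ω ω' : ι → X}
    (hne : coordAvg μ s
      (fun η => ∏ t ∈ Finset.univ.filter (fun t => ¬ ∃ j ∈ K, j ∈ rd t), f t η) ω ≠ 0)
    (hne' : coordAvg μ s
      (fun η => ∏ t ∈ Finset.univ.filter (fun t => ¬ ∃ j ∈ K, j ∈ rd t), f t η) ω' ≠ 0)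
    (h : ∀ t, (∃ j ∈ K, j ∈ rd t) → ∀ i ∈ rd t, i ∉ s → ω i = ω' i) :
    coordAvg μ s (fun η => ∏ t, f t η) ω / coordAvg μ (insert a s) (fun η => ∏ t, f t η) ω =
      coordAvg μ s (fun η => ∏ t, f t η) ω' /
        coordAvg μ (insert a s) (fun η => ∏ t, f t η) ω' := by
  classical
  let P : τ → Prop := fun t => ∃ j ∈ K, j ∈ rd t
  -- split the weight into the terms touching `K` and the others
  have hsplit : (fun η : ι → X => ∏ t, f t η) = fun η =>
      (∏ t ∈ Finset.univ.filter P, f t η) *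
        ∏ t ∈ Finset.univ.filter (fun t => ¬ P t), f t η := by
    funext η
    rw [Finset.prod_filter_mul_prod_filter_not]
  have hw₁ := dependsOn_prod_filter f rd hf P
  have hw₂ := dependsOn_prod_filter f rd hf (fun t => ¬ P t)
  have ha : a ∉ {i | ∃ t, ¬ P t ∧ i ∈ rd t} := by
    rintro ⟨t, hnt, hat⟩
    exact hnt ⟨a, haK, hat⟩
  have hdisj : ∀ i ∈ s, i ∈ {i | ∃ t, P t ∧ i ∈ rd t} → i ∉ {i | ∃ t, ¬ P t ∧ i ∈ rd t} := by
    rintro i his ⟨t, hPt, hit⟩ ⟨t', hnt', hit'⟩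
    have hiK : i ∈ K := hclosed t hPt i hit (Finset.mem_insert_of_mem his)
    exact hnt' ⟨i, hiK, hit'⟩
  rw [hsplit]
  exact arConditional_congr_of_factor μ s a hw₁ hw₂ ha hdisj hne hne'
    (fun i ⟨t, hPt, hit⟩ his => h t hPt i hit his)

omit [Fintype ι] in
/-- Measurability of gluing fresh coordinates into `ω` along `s`. [ours] -/
theorem measurable_piecewise_left (s : Finset ι) (ω : ι → X) :
    Measurable fun η : ι → X => s.piecewise η ω :=
  (measurable_piecewise_prod s).comp measurable_prodMk_left

/-- **The frontier bound for POSITIVE bounded measurable terms** (no non-vanishing hypothesis):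
under the closed-block hypothesis of `arConditional_prod_congr_of_closedBlock`, the exact conditional
of `a` takes the same value on configurations agreeing, off `s`, on the coordinates read by the terms
touching the block. [ours] -/
theorem arConditional_prod_congr_of_closedBlock_pos (s : Finset ι) (a : ι) (f : τ → (ι → X) → ℝ)
    (rd : τ → Finset ι) (hf : ∀ t, DependsOn (f t) (rd t : Set ι))
    (hmeas : ∀ t, Measurable (f t)) (hpos : ∀ t η, 0 < f t η) (hbdd : ∀ t, ∃ C, ∀ η, f t η ≤ C)
    (K : Finset ι) (haK : a ∈ K)
    (hclosed : ∀ t, (∃ j ∈ K, j ∈ rd t) → ∀ i ∈ rd t, i ∈ insert a s → i ∈ K)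
    {ω ω' : ι → X} (h : ∀ t, (∃ j ∈ K, j ∈ rd t) → ∀ i ∈ rd t, i ∉ s → ω i = ω' i) :
    coordAvg μ s (fun η => ∏ t, f t η) ω / coordAvg μ (insert a s) (fun η => ∏ t, f t η) ω =
      coordAvg μ s (fun η => ∏ t, f t η) ω' /
        coordAvg μ (insert a s) (fun η => ∏ t, f t η) ω' := by
  classical
  set w₂ : (ι → X) → ℝ :=
    fun η => ∏ t ∈ Finset.univ.filter (fun t => ¬ ∃ j ∈ K, j ∈ rd t), f t η with hw₂
  have hw₂pos : ∀ η, 0 < w₂ η := fun η => Finset.prod_pos fun t _ => hpos t η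
  choose C hC using hbdd
  have hw₂le : ∀ η, w₂ η ≤ ∏ t ∈ Finset.univ.filter (fun t => ¬ ∃ j ∈ K, j ∈ rd t), C t :=
    fun η => Finset.prod_le_prod (fun t _ => (hpos t η).le) fun t _ => hC t η
  have hw₂m : Measurable w₂ := Finset.measurable_prod _ fun t _ => hmeas t
  have hint : ∀ ω₀ : ι → X,
      Integrable (fun η : ι → X => w₂ (s.piecewise η ω₀)) (Measure.pi fun _ => μ) := by
    intro ω₀
    refine Integrable.mono'
      (integrable_const (∏ t ∈ Finset.univ.filter (fun t => ¬ ∃ j ∈ K, j ∈ rd t), C t))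
      ((hw₂m.comp (measurable_piecewise_left s ω₀)).aestronglyMeasurable)
      (ae_of_all _ fun η => ?_)
    rw [Real.norm_eq_abs, abs_of_pos (hw₂pos _)]
    exact hw₂le _
  exact arConditional_prod_congr_of_closedBlock μ s a f rd hf K haK hclosed
    (coordAvg_pos_of_pos μ s hw₂pos ω (hint ω)).ne' (coordAvg_pos_of_pos μ s hw₂pos ω' (hint ω')).ne' h

end Block

section Frontier

open Literature.Combinatorics.SimpleGraph Literature.LinearAlgebra.Matrix.ChordalSparsity

variable {V : Type*} [Fintype V] [LinearOrder V] [DecidableEq V]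
variable {τ : Type*} [Fintype τ]

/-- **THE EXACT KR CONDITIONAL READS ONLY THE CURRENT VARIABLE AND THE OUTER BOUNDARY OF ITS LOWER
COMPONENT.**  Let `w = ∏_t f t` with positive bounded measurable terms, the term `t` reading only a
CLIQUE `rd t` of the graph `G` on the variables.  Order the variables linearly and let
`s = {u | u < a}` (the variables generated after `a` when generating from the top).  If `ω, ω'`
agree at `a` and on `outer G (lowerComp G a)`, the exact conditional `A_s w / A_{insert a s} w` of
`a` takes the same value at `ω` and `ω'`. [ours] -/
theorem arConditional_congr_of_frontier (G : SimpleGraph V) (a : V) (f : τ → (V → X) → ℝ)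
    (rd : τ → Finset V) (hf : ∀ t, DependsOn (f t) (rd t : Set V))
    (hclique : ∀ t, ∀ i ∈ rd t, ∀ j ∈ rd t, i ≠ j → G.Adj i j)
    (hmeas : ∀ t, Measurable (f t)) (hpos : ∀ t η, 0 < f t η) (hbdd : ∀ t, ∃ C, ∀ η, f t η ≤ C)
    {ω ω' : V → X} (ha : ω a = ω' a) (h : ∀ v ∈ outer G (lowerComp G a), ω v = ω' v) :
    coordAvg μ (Finset.univ.filter (· < a)) (fun η => ∏ t, f t η) ω /
        coordAvg μ (insert a (Finset.univ.filter (· < a))) (fun η => ∏ t, f t η) ω =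
      coordAvg μ (Finset.univ.filter (· < a)) (fun η => ∏ t, f t η) ω' /
        coordAvg μ (insert a (Finset.univ.filter (· < a))) (fun η => ∏ t, f t η) ω' := by
  classical
  set s : Finset V := Finset.univ.filter (· < a) with hs
  -- the closed block: the lower component of `a`
  let K : Finset V := Finset.univ.filter (· ∈ lowerComp G a)
  have hmemK : ∀ u, u ∈ K ↔ u ∈ lowerComp G a := fun u => by simp [K]
  have haK : a ∈ K := (hmemK a).2 (mem_lowerComp_self a)
  have hle : ∀ i, i ∈ insert a s → i ≤ a := by
    intro i hi
    rcases Finset.mem_insert.1 hi with rfl | hi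
    · exact le_rfl
    · exact (Finset.mem_filter.1 hi).2.le
  have hclosed : ∀ t, (∃ j ∈ K, j ∈ rd t) → ∀ i ∈ rd t, i ∈ insert a s → i ∈ K := by
    rintro t ⟨j, hjK, hjt⟩ i hit hias
    by_cases hij : j = i
    · exact hij ▸ hjK
    · exact (hmemK i).2
        (mem_lowerComp_of_adj ((hmemK j).1 hjK) (hclique t j hjt i hit hij) (hle i hias))
  refine arConditional_prod_congr_of_closedBlock_pos μ s a f rd hf hmeas hpos hbdd K haK hclosed
    fun t ⟨j, hjK, hjt⟩ i hit his => ?_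
  -- a coordinate read by a term touching the block, not integrated: `a` itself or a frontier vertex
  by_cases hia : i = a
  · rw [hia]; exact ha
  have hai : a < i := by
    rcases lt_or_ge i a with hlt | hge
    · exact absurd (Finset.mem_filter.2 ⟨Finset.mem_univ i, hlt⟩) his
    · exact lt_of_le_of_ne hge (Ne.symm hia)
  refine h i ⟨fun hiK => absurd (le_of_mem_lowerComp hiK) (not_le.2 hai), j, (hmemK j).1 hjK, ?_⟩
  exact hclique t j hjt i hit fun hji => (not_le.2 hai) (hji ▸ le_of_mem_lowerComp ((hmemK j).1 hjK))

/-- **… EQUIVALENTLY, ONLY THE CURRENT VARIABLE AND ITS HIGHER FILL-NEIGHBOURHOOD `adj⁺(a)` IN THE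
ELIMINATION GRAPH** (GEN-14 `higherAdj_elimGraph_eq_outer_lowerComp`): the typed form of the upper
half of THEORY-2's triangular-footprint bracket (T2-AF (a), E27 Thm 5.1) for factorising weights.
[ours] -/
theorem arConditional_congr_of_higherAdj (G : SimpleGraph V) (a : V) (f : τ → (V → X) → ℝ)
    (rd : τ → Finset V) (hf : ∀ t, DependsOn (f t) (rd t : Set V))
    (hclique : ∀ t, ∀ i ∈ rd t, ∀ j ∈ rd t, i ≠ j → G.Adj i j)
    (hmeas : ∀ t, Measurable (f t)) (hpos : ∀ t η, 0 < f t η) (hbdd : ∀ t, ∃ C, ∀ η, f t η ≤ C)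
    {ω ω' : V → X} (ha : ω a = ω' a)
    (h : ∀ v ∈ higherAdj (elimGraph G).Adj a, ω v = ω' v) :
    coordAvg μ (Finset.univ.filter (· < a)) (fun η => ∏ t, f t η) ω /
        coordAvg μ (insert a (Finset.univ.filter (· < a))) (fun η => ∏ t, f t η) ω =
      coordAvg μ (Finset.univ.filter (· < a)) (fun η => ∏ t, f t η) ω' /
        coordAvg μ (insert a (Finset.univ.filter (· < a))) (fun η => ∏ t, f t η) ω' := by
  rw [higherAdj_elimGraph_eq_outer_lowerComp] at h
  exact arConditional_congr_of_frontier μ G a f rd hf hclique hmeas hpos hbdd ha h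

end Frontier

end Summit.Ventures.LatticeQCDFlow.Theory2.Autoregressive

end
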